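import Mathlib
import Summits.KontsevichZagierPeriods.KontsevichZagierPeriods.Theorems.InverseLandauTateLiftingPullback
import Summits.KontsevichZagierPeriods.KontsevichZagierPeriods.Theorems.InverseLandauTateLiftingSphereArea
import Summits.KontsevichZagierPeriods.KontsevichZagierPeriods.Theorems.InverseLandauTateLiftingTubeIsTwist
import Summits.KontsevichZagierPeriods.KontsevichZagierPeriods.Theorems.GammaHodgeSector.Negative.Calibration
import Summits.KontsevichZagierPeriods.KontsevichZagierPeriods.Theorems.UnfoldedStokesLegendreAllModuliStubStripNewtonLeibniz
import Summits.KontsevichZagierPeriods.KontsevichZagierPeriods.Theorems.UnfoldedStokesLegendreAllModuliStubHalfLineTail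

/-!
# `TateLifting` (stmt-KontsevichZagierPeriods-9129), line `Sketch` — THE VOLUME OF `S³` INSIDE THE RULES
# (stub `tateLifting_threeSphereVolume` = item `ThreeSphereVolume`, stmt-KontsevichZagierPeriods-4308, of
# route LinkTwistWrithe, verbatim)

`[ℝ³, 8/(1+|x|²)³] − 2·[D × D, 1] ∈ KZ.relations` (`D` the open unit disc): the round volume density of the
unit `3`-sphere in the stereographic chart (value `vol S³ = 2π²`) against twice the bidisc (value `π²`),
derived by the moves of the Kontsevich–Zagier calculus (`tateLifting_threeSphereVolume`):
1. `r = [ℝ³, 8/(1+|x|²)³]` is invariant under the rotations of its last two coordinates, so the ROTATION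
   REDUCTION `rotation_reduce` (`n = 1`) gives `[r] ≡ [m₃]·[disc]`, `m₃ = [{w > 0}, 16w/(1+v²+w²)³]` the
   honest meridian over the open upper half-plane;
2. ONE change of variables (rule 2, `tateLifting_pullback`) along the SCALING CHART
   `Ψ(v, w) = (v, w√(1+v²))` of the upper half-plane onto itself (Jacobian `(1, 0; wv/√(1+v²), √(1+v²))`,
   `|det Ψ′| = √(1+v²)`, a `ℚ`-semialgebraic bijection) pulls `m₃` back to
   `[{w > 0}, 16w/((1+v²)²(1+w²)³)]` (`1 + v² + w²(1+v²) = (1+v²)(1+w²)`), which is the Fubini product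
   (rule 1) of the honest factors `A = [ℝ, 1/(1+v²)²]` (value `π/2`, primitive `(arctan v + v/(1+v²))/2`)
   and `m = [(0,∞), 16w/(1+w²)³]` (value `4`, primitive `−4/(1+w²)²`);
3. values only: `[m] − 4·[pt, 1]` and `2·[A] − [ℝ, 1/(1+v²)]` are vanishing combinations of generators of
   the landed dimension-`≤ 1` algebraic sector, hence relations (`kzKernelConjecture_lowDimAlg`);
   `[ℝ, 1/(1+v²)] ∼ [disc]` is the tree's `PiNormalisation` (`TubeIsTwist.cauchy_equivalent_piRep`);
4. `[D × D, 1]` is the product of two open discs (rule 1), `[open disc] ∼ [closed disc]`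
   (`GammaHodgeSectorNegative.equivalent_piRep_discRep`), and `⟦r⟧ − 2⟦r'⟧ = ⟦A⟧·4·⟦π⟧ − 2⟦π⟧² = 0`
   (as `2⟦A⟧ = ⟦π⟧`) in the commutative formal period ring `KZ.FormalPeriodRing = FormalRep ⧸ relations`.

References: M. Kontsevich, D. Zagier, *Periods* (2001), §1.1 eq. (1), §1.2 rules (1)–(3), §4.1.
-/

noncomputable section

open MeasureTheory Set Filter Topology
open Literature.NumberTheory.Transcendental
open Literature.ModelTheory.ExponentialFields (IsSemialgebraic isSemialgebraic_univ)
open MvPolynomial (aeval X C)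
open Summit.KontsevichZagierPeriods.UnfoldedStokes.LegendreAllModuliLine.M4 (isSemialgebraic_pos1)
open Summit.KontsevichZagierPeriods.UnfoldedStokes.LegendreAllModuliLine.M5 (isSemialgebraic_posSet)

namespace Summit.KontsevichZagierPeriods.InverseLandau

namespace ThreeSphere

/-! ## The two honest one-dimensional factors and their values -/

/-- Transport `ℝ¹ → ℝ` of an integral over the whole line (`volume_preserving_funUnique`). [folklore] -/
theorem integral_fin_one_univ (g : ℝ → ℝ) :
    ∫ x in (Set.univ : Set (Fin 1 → ℝ)), g (x 0) = ∫ t, g t := by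
  rw [Measure.restrict_univ]
  exact (volume_preserving_funUnique (Fin 1) ℝ).integral_comp' g

/-- `1/(1+t²)²` is absolutely integrable on `ℝ` (dominated by `1/(1+t²)`). [folklore] -/
theorem integrable_quartic : Integrable fun t : ℝ => 1 / (1 + t ^ 2) ^ 2 := by
  have hc : Continuous fun t : ℝ => 1 / (1 + t ^ 2) ^ 2 :=
    continuous_const.div (by fun_prop) fun t => by positivity
  refine integrable_inv_one_add_sq.mono' hc.aestronglyMeasurable (Eventually.of_forall fun t => ?_)
  have h1 : (1 : ℝ) ≤ 1 + t ^ 2 := by nlinarith [sq_nonneg t]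
  rw [Real.norm_eq_abs, abs_of_nonneg (by positivity), one_div]
  exact inv_anti₀ (by positivity) (by nlinarith)

/-- `d/dt [(arctan t + t/(1+t²))/2] = 1/(1+t²)²`. [folklore] -/
theorem hasDerivAt_quarticPrim (t : ℝ) :
    HasDerivAt (fun t : ℝ => (Real.arctan t + t / (1 + t ^ 2)) / 2) (1 / (1 + t ^ 2) ^ 2) t := by
  have hne : (1 + t ^ 2 : ℝ) ≠ 0 := by positivity
  have h1 : HasDerivAt (fun t : ℝ => 1 + t ^ 2) (2 * t) t :=
    ((hasDerivAt_pow 2 t).const_add 1).congr_deriv (by norm_num)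
  refine (((Real.hasDerivAt_arctan t).add ((hasDerivAt_id' t).div h1 hne)).div_const 2).congr_deriv ?_
  field_simp
  ring

/-- `t/(1+t²) → 0` as `t → +∞` (squeezed between `0` and `1/t`). [folklore] -/
theorem tendsto_div_one_add_sq_atTop : Tendsto (fun t : ℝ => t / (1 + t ^ 2)) atTop (𝓝 0) := by
  refine squeeze_zero' ((eventually_ge_atTop 0).mono fun t ht => by positivity)
    ((eventually_gt_atTop 0).mono fun t ht => ?_) tendsto_inv_atTop_zero
  rw [div_le_iff₀ (by positivity), inv_mul_eq_div, le_div_iff₀ ht]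
  nlinarith

/-- `t/(1+t²) → 0` as `t → −∞` (odd function). [folklore] -/
theorem tendsto_div_one_add_sq_atBot : Tendsto (fun t : ℝ => t / (1 + t ^ 2)) atBot (𝓝 0) := by
  have h : Tendsto (fun t : ℝ => -(-t / (1 + (-t) ^ 2))) atBot (𝓝 (-0)) :=
    (tendsto_div_one_add_sq_atTop.comp tendsto_neg_atBot_atTop).neg
  rw [neg_zero] at h
  exact Tendsto.congr (fun t => by ring) h

/-- **`∫_ℝ dt/(1+t²)² = π/2`** (FTC on the line, limits `±π/4` of the primitive). [folklore] -/
theorem integral_quartic : ∫ t : ℝ, 1 / (1 + t ^ 2) ^ 2 = Real.pi / 2 := by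
  have htop : Tendsto (fun t : ℝ => (Real.arctan t + t / (1 + t ^ 2)) / 2) atTop
      (𝓝 ((Real.pi / 2 + 0) / 2)) :=
    ((tendsto_nhds_of_tendsto_nhdsWithin Real.tendsto_arctan_atTop).add
      tendsto_div_one_add_sq_atTop).div_const 2
  have hbot : Tendsto (fun t : ℝ => (Real.arctan t + t / (1 + t ^ 2)) / 2) atBot
      (𝓝 ((-(Real.pi / 2) + 0) / 2)) :=
    ((tendsto_nhds_of_tendsto_nhdsWithin Real.tendsto_arctan_atBot).add
      tendsto_div_one_add_sq_atBot).div_const 2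
  rw [integral_of_hasDerivAt_of_tendsto hasDerivAt_quarticPrim integrable_quartic hbot htop]
  ring

/-- **The factor `A = [ℝ, 1/(1+t²)²]` exists** (rational integrand, absolutely integrable) and has the
value `π/2`. [folklore] -/
theorem exists_quarticRep : ∃ A : KZ.IntegralRep 1, A.domain = Set.univ ∧
    (A.integrand = fun t => 1 / (1 + t 0 ^ 2) ^ 2) ∧ A.value = Real.pi / 2 := by
  have hsa : IsSemialgebraicFunOn ℚ (univ : Set (Fin 1 → ℝ)) (fun t => 1 / (1 + t 0 ^ 2) ^ 2) := by
    refine (isSemialgebraicFunOn_aeval_div_aeval isSemialgebraic_univ (1 : MvPolynomial (Fin 1) ℚ)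
      ((1 + X 0 ^ 2) ^ 2) fun t _ => ?_).congr fun t _ => ?_
    · have ht : (0 : ℝ) < (1 + t 0 ^ 2) ^ 2 := by positivity
      simpa using ht.ne'
    · simp
  have hint : IntegrableOn (fun t : Fin 1 → ℝ => 1 / (1 + t 0 ^ 2) ^ 2) univ :=
    (((volume_preserving_funUnique (Fin 1) ℝ).integrable_comp
      integrable_quartic.aestronglyMeasurable).2 integrable_quartic).integrableOn
  refine ⟨⟨_, _, isSemialgebraic_univ, hsa, hint⟩, rfl, rfl, ?_⟩
  exact (integral_fin_one_univ (fun t => 1 / (1 + t ^ 2) ^ 2)).trans integral_quartic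

/-- `d/dρ [−4/(1+ρ²)²] = 16ρ/(1+ρ²)³`. [folklore] -/
theorem hasDerivAt_meridianPrim (ρ : ℝ) :
    HasDerivAt (fun ρ : ℝ => -4 * ((1 + ρ ^ 2) ^ 2)⁻¹) (16 * ρ / (1 + ρ ^ 2) ^ 3) ρ := by
  have h1 : HasDerivAt (fun ρ : ℝ => 1 + ρ ^ 2) (2 * ρ) ρ :=
    ((hasDerivAt_pow 2 ρ).const_add 1).congr_deriv (by norm_num)
  have h2 : HasDerivAt (fun ρ : ℝ => (1 + ρ ^ 2) ^ 2) (↑(2 : ℕ) * (1 + ρ ^ 2) ^ (2 - 1) * (2 * ρ)) ρ :=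
    h1.pow 2
  refine ((h2.inv (by positivity)).const_mul (-4 : ℝ)).congr_deriv ?_
  rw [show (2 - 1 : ℕ) = 1 from rfl, pow_one]
  push_cast
  field_simp
  ring

/-- `−4/(1+ρ²)² → 0` as `ρ → +∞`. [folklore] -/
theorem tendsto_meridianPrim : Tendsto (fun ρ : ℝ => -4 * ((1 + ρ ^ 2) ^ 2)⁻¹) atTop (𝓝 0) := by
  have h : Tendsto (fun ρ : ℝ => (1 + ρ ^ 2) ^ 2) atTop atTop := (tendsto_pow_atTop two_ne_zero).comp
    (tendsto_atTop_add_const_left _ _ (tendsto_pow_atTop two_ne_zero))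
  simpa using (tendsto_inv_atTop_zero.comp h).const_mul (-4 : ℝ)

/-- **`∫₀^∞ 16ρ dρ/(1+ρ²)³ = 4`** (FTC on the half-line, `integral_Ioi_of_hasDerivAt_of_nonneg'`).
[folklore] -/
theorem integral_Ioi_meridian3 : ∫ ρ in Ioi (0 : ℝ), 16 * ρ / (1 + ρ ^ 2) ^ 3 = 4 := by
  rw [integral_Ioi_of_hasDerivAt_of_nonneg' (fun ρ _ => hasDerivAt_meridianPrim ρ)
    (fun ρ hρ => by have : (0 : ℝ) < ρ := hρ; positivity) tendsto_meridianPrim]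
  norm_num

/-- **The factor `m = [(0,∞), 16ρ/(1+ρ²)³]` exists** (rational integrand, absolutely integrable as the
non-negative derivative of a function with a limit at `+∞`) and has the value `4`. [folklore] -/
theorem exists_meridianRep : ∃ m : KZ.IntegralRep 1, m.domain = {q : Fin 1 → ℝ | 0 < q 0} ∧
    (m.integrand = fun q => 16 * q 0 / (1 + q 0 ^ 2) ^ 3) ∧ m.value = 4 := by
  have hsa : IsSemialgebraicFunOn ℚ {q : Fin 1 → ℝ | 0 < q 0}
      (fun q => 16 * q 0 / (1 + q 0 ^ 2) ^ 3) := by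
    refine (isSemialgebraicFunOn_aeval_div_aeval isSemialgebraic_posSet
      (C 16 * X 0 : MvPolynomial (Fin 1) ℚ) ((1 + X 0 ^ 2) ^ 3) fun q _ => ?_).congr fun q _ => ?_
    · have hq : (0 : ℝ) < (1 + q 0 ^ 2) ^ 3 := by positivity
      simpa using hq.ne'
    · simp
  have hint : IntegrableOn (fun q : Fin 1 → ℝ => 16 * q 0 / (1 + q 0 ^ 2) ^ 3) {q | 0 < q 0} :=
    (KZ.integrableOn_setOf_apply_mem_iff (g := fun ρ : ℝ => 16 * ρ / (1 + ρ ^ 2) ^ 3)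
      (S := Ioi 0)).2 (integrableOn_Ioi_deriv_of_nonneg' (fun ρ _ => hasDerivAt_meridianPrim ρ)
        (fun ρ hρ => by have : (0 : ℝ) < ρ := hρ; positivity) tendsto_meridianPrim)
  refine ⟨⟨_, _, isSemialgebraic_posSet, hsa, hint⟩, rfl, rfl, ?_⟩
  exact (SphereChart.setIntegral_fin_one_Ioi (fun ρ => 16 * ρ / (1 + ρ ^ 2) ^ 3)).trans
    integral_Ioi_meridian3

/-- A one-dimensional representation reading `p(x)/q(x)` on its domain, `p, q ∈ ℚ[x]`, `q ≠ 0` there, is a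
generator of the dimension-`≤ 1` algebraic sector of `kzKernelConjecture_lowDimAlg`. [folklore] -/
theorem of_mem_lowDimGen (ρ : KZ.IntegralRep 1) (p q : Polynomial ℚ)
    (hq : ∀ x ∈ ρ.domain, (q.map (algebraMap ℚ ℝ)).eval (x 0) ≠ 0)
    (h : Set.EqOn ρ.integrand
      (fun x => (p.map (algebraMap ℚ ℝ)).eval (x 0) / (q.map (algebraMap ℚ ℝ)).eval (x 0)) ρ.domain) :
    KZ.of ρ ∈ AddSubgroup.closure
      {d : KZ.FormalRep | (∃ r : KZ.IntegralRep 0, d = KZ.of r) ∨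
        ∃ (r : KZ.IntegralRep 1) (p q : Polynomial ℝ), (∀ i, IsAlgebraic ℚ (p.coeff i)) ∧
          (∀ i, IsAlgebraic ℚ (q.coeff i)) ∧ (∀ x ∈ r.domain, q.eval (x 0) ≠ 0) ∧
          Set.EqOn r.integrand (fun x => p.eval (x 0) / q.eval (x 0)) r.domain ∧ d = KZ.of r} :=
  AddSubgroup.subset_closure (Or.inr ⟨ρ, p.map (algebraMap ℚ ℝ), q.map (algebraMap ℚ ℝ),
    SphereChart.isAlgebraic_coeff_map _, SphereChart.isAlgebraic_coeff_map _, hq, h, rfl⟩)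

/-- Evaluation of the numerator `16X` of the meridian reading. [folklore] -/
theorem eval_sixteenX (t : ℝ) :
    ((Polynomial.C 16 * Polynomial.X : Polynomial ℚ).map (algebraMap ℚ ℝ)).eval t = 16 * t := by
  simp

/-- Evaluation of the denominator `(1 + X²)³` of the meridian reading. [folklore] -/
theorem eval_cube (t : ℝ) :
    (((1 + Polynomial.X ^ 2) ^ 3 : Polynomial ℚ).map (algebraMap ℚ ℝ)).eval t = (1 + t ^ 2) ^ 3 := by
  simp

/-- Evaluation of the denominator `1 + X²` of the Cauchy reading. [folklore] -/
theorem eval_oneAddSq (t : ℝ) :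
    ((1 + Polynomial.X ^ 2 : Polynomial ℚ).map (algebraMap ℚ ℝ)).eval t = 1 + t ^ 2 := by
  simp

/-- The Jacobian `(1, 0; wv/√(1+v²), √(1+v²))` of the scaling chart has absolute determinant `√(1+v²)`.
[folklore] -/
theorem abs_det_scale (z : Fin 2 → ℝ) :
    |(LinearMap.toContinuousLinearMap
        (Matrix.toLin' !![(1 : ℝ), 0; z 1 * (z 0 / √(1 + z 0 ^ 2)), √(1 + z 0 ^ 2)])).det| =
      √(1 + z 0 ^ 2) := by
  rw [LinearMap.det_toContinuousLinearMap, LinearMap.det_toLin', Matrix.det_fin_two_of,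
    one_mul, zero_mul, sub_zero]
  exact abs_of_pos (Real.sqrt_pos.2 (by positivity))

/-- The scaling chart is differentiable with derivative its Jacobian (`hasFDerivAt_apply`, chain rule
for `√(1+v²)`, product rule). [folklore] -/
theorem hasFDerivAt_scale (z : Fin 2 → ℝ) :
    HasFDerivAt (fun y : Fin 2 → ℝ => (![y 0, y 1 * √(1 + y 0 ^ 2)] : Fin 2 → ℝ))
      (LinearMap.toContinuousLinearMap
        (Matrix.toLin' !![(1 : ℝ), 0; z 1 * (z 0 / √(1 + z 0 ^ 2)), √(1 + z 0 ^ 2)])) z := by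
  have h0 : HasFDerivAt (fun y : Fin 2 → ℝ => y 0)
      (ContinuousLinearMap.proj (R := ℝ) (φ := fun _ : Fin 2 => ℝ) 0) z := hasFDerivAt_apply 0 z
  have h1 : HasFDerivAt (fun y : Fin 2 → ℝ => y 1)
      (ContinuousLinearMap.proj (R := ℝ) (φ := fun _ : Fin 2 => ℝ) 1) z := hasFDerivAt_apply 1 z
  have hsq : HasDerivAt (fun t : ℝ => √(1 + t ^ 2)) (z 0 / √(1 + z 0 ^ 2)) (z 0) := by
    have h := (((hasDerivAt_pow 2 (z 0)).const_add 1).congr_deriv (by norm_num) :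
      HasDerivAt (fun t : ℝ => 1 + t ^ 2) (2 * z 0) (z 0)).sqrt (by positivity)
    exact h.congr_deriv (by rw [mul_div_mul_left _ _ two_ne_zero])
  rw [hasFDerivAt_pi']
  refine Fin.forall_fin_two.mpr ⟨?_, ?_⟩
  · exact h0.congr_fderiv (ContinuousLinearMap.ext fun v => by
      simp [Matrix.toLin'_apply, dotProduct, Fin.sum_univ_two])
  · refine (h1.mul (hsq.comp_hasFDerivAt z h0)).congr_fderiv (ContinuousLinearMap.ext fun v => ?_)
    simp [Matrix.toLin'_apply, dotProduct, Fin.sum_univ_two]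
    ring

/-- The scaling chart is injective on the upper half-plane (`√(1+v²) ≠ 0`). [folklore] -/
theorem injOn_scale :
    InjOn (fun y : Fin 2 → ℝ => (![y 0, y 1 * √(1 + y 0 ^ 2)] : Fin 2 → ℝ)) {p | 0 < p 1} := by
  intro x _ y _ hxy
  have h0 : x 0 = y 0 := by simpa using congrFun hxy 0
  have h1 : x 1 = y 1 := by
    have h := congrFun hxy 1
    simp only [Matrix.cons_val_one, Matrix.cons_val_fin_one, h0] at h
    exact mul_right_cancel₀ (Real.sqrt_pos.2 (by positivity)).ne' h
  exact funext (Fin.forall_fin_two.mpr ⟨h0, h1⟩)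

/-- The scaling chart maps the upper half-plane onto itself (inverse `(v, w) ↦ (v, w/√(1+v²))`).
[folklore] -/
theorem image_scale :
    (fun y : Fin 2 → ℝ => (![y 0, y 1 * √(1 + y 0 ^ 2)] : Fin 2 → ℝ)) '' {p | 0 < p 1} =
      {p : Fin 2 → ℝ | 0 < p 1} := by
  refine Set.ext fun q => ⟨?_, fun hq => ?_⟩
  · rintro ⟨p, hp, rfl⟩
    exact mul_pos (show 0 < p 1 from hp) (Real.sqrt_pos.2 (by positivity))
  · refine ⟨![q 0, q 1 / √(1 + q 0 ^ 2)], div_pos (show 0 < q 1 from hq) (Real.sqrt_pos.2 (by positivity)),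
      funext fun i => ?_⟩
    fin_cases i
    · rfl
    · exact div_mul_cancel₀ (q 1) (Real.sqrt_pos.2 (by positivity) : 0 < √(1 + q 0 ^ 2)).ne'

/-- The Jacobian factor `√(1+v²)` is `ℚ`-semialgebraic on the upper half-plane (square root of a
polynomial). [cite: BCR1998, §2.2] -/
theorem isSemialgebraicFunOn_jac :
    IsSemialgebraicFunOn ℚ {p : Fin 2 → ℝ | 0 < p 1} (fun z : Fin 2 → ℝ => √(1 + z 0 ^ 2)) := by
  refine IsSemialgebraicFunOn.sqrt_holds (f := fun z : Fin 2 → ℝ => 1 + z 0 ^ 2) ?_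
  exact (isSemialgebraicFunOn_aeval isSemialgebraic_pos1 (1 + X 0 ^ 2 : MvPolynomial (Fin 2) ℚ)).congr
    fun z _ => by simp

/-- The scaling chart is a `ℚ`-semialgebraic map on the upper half-plane (a coordinate, and a coordinate
times `√(1+v²)`). [cite: BCR1998, §2.2] -/
theorem isSemialgebraicMapOn_scale :
    IsSemialgebraicMapOn ℚ {p : Fin 2 → ℝ | 0 < p 1}
      (fun y : Fin 2 → ℝ => (![y 0, y 1 * √(1 + y 0 ^ 2)] : Fin 2 → ℝ)) := by
  refine IsSemialgebraicMapOn.of_forall isSemialgebraic_pos1 (Fin.forall_fin_two.mpr ⟨?_, ?_⟩)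
  · exact (isSemialgebraicFunOn_apply isSemialgebraic_pos1 0).congr fun y _ => by simp
  · exact (IsSemialgebraicFunOn.mul_holds (isSemialgebraicFunOn_apply isSemialgebraic_pos1 1)
      isSemialgebraicFunOn_jac).congr fun y _ => by simp

end ThreeSphere

open ThreeSphere
open Summit.KontsevichZagierPeriods.GammaHodgeSectorNegative (discRep equivalent_piRep_discRep)

/-- **THE VOLUME OF `S³` INSIDE THE RULES** (stub `stub_threeSphereVolume`; item `ThreeSphereVolume`,
stmt-KontsevichZagierPeriods-4308, route LinkTwistWrithe, verbatim). For every `r = [ℝ³, f]` with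
`f = 8/(1+|x|²)³` on `ℝ³` and every `r' = [D × D, g]` over the product of two open unit discs with `g = 1`
there: `[r] − 2·[r'] ∈ KZ.relations` — rotation reduction to the meridian over the upper half-plane, ONE
change of variables along the scaling chart `(v, w) ↦ (v, w√(1+v²))`, product splitting into
`[ℝ, 1/(1+v²)²] × [(0,∞), 16w/(1+w²)³]` (values `π/2`, `4`), the landed dimension-`≤ 1` algebraic sector,
`[ℝ, 1/(1+v²)] ∼ [disc]`, `[D × D, 1] ≡ [disc]·[disc]`, and an identity in the formal period ring (see the
module docstring). [cite: KontsevichZagier2001, §1.2] -/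
theorem tateLifting_threeSphereVolume :
    ∀ (r : KZ.IntegralRep 3) (r' : KZ.IntegralRep 4), r.domain = Set.univ → Set.EqOn r.integrand (fun x : Fin 3 → ℝ => 8 / (1 + x 0 ^ 2 + x 1 ^ 2 + x 2 ^ 2) ^ 3) r.domain → r'.domain = {w : Fin 4 → ℝ | w 0 ^ 2 + w 1 ^ 2 < 1 ∧ w 2 ^ 2 + w 3 ^ 2 < 1} → Set.EqOn r'.integrand (fun _ => (1 : ℝ)) r'.domain → KZ.of r - 2 • KZ.of r' ∈ KZ.relations := by
  intro r r' hrd hri hr'd hr'i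
  have hc0 : (Fin.castAdd 1 (0 : Fin 1) : Fin 2) = 0 := rfl
  have hn0 : (Fin.natAdd 1 (0 : Fin 1) : Fin 2) = 1 := rfl
  -- the integrand of `r` is the density everywhere (its domain is all of `ℝ³`)
  have hri' : r.integrand = fun x : Fin 3 → ℝ => 8 / (1 + x 0 ^ 2 + x 1 ^ 2 + x 2 ^ 2) ^ 3 :=
    funext fun x => hri (by rw [hrd]; exact mem_univ x)
  -- Step 1: rotation invariance in the last two coordinates and the honest meridian (`n = 1`)
  have hinv : ∀ x ∈ r.domain, ∀ a b : ℝ, a ^ 2 + b ^ 2 = 1 →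
      (Fin.snoc (Fin.snoc (Fin.init (Fin.init x : Fin 2 → ℝ) : Fin 1 → ℝ)
          (a * (Fin.init x : Fin 2 → ℝ) (Fin.last 1) - b * x (Fin.last 2)) : Fin 2 → ℝ)
          (b * (Fin.init x : Fin 2 → ℝ) (Fin.last 1) + a * x (Fin.last 2)) : Fin 3 → ℝ) ∈ r.domain ∧
      r.integrand (Fin.snoc (Fin.snoc (Fin.init (Fin.init x : Fin 2 → ℝ) : Fin 1 → ℝ)
          (a * (Fin.init x : Fin 2 → ℝ) (Fin.last 1) - b * x (Fin.last 2)) : Fin 2 → ℝ)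
          (b * (Fin.init x : Fin 2 → ℝ) (Fin.last 1) + a * x (Fin.last 2)) : Fin 3 → ℝ) =
        r.integrand x := by
    intro x _ a b hab
    refine ⟨by rw [hrd]; exact mem_univ _, ?_⟩
    have key : (a * x 1 - b * x 2) ^ 2 + (b * x 1 + a * x 2) ^ 2 = x 1 ^ 2 + x 2 ^ 2 := by
      linear_combination (x 1 ^ 2 + x 2 ^ 2) * hab
    rw [hri']
    show 8 / (1 + x 0 ^ 2 + (a * x 1 - b * x 2) ^ 2 + (b * x 1 + a * x 2) ^ 2) ^ 3 =
      8 / (1 + x 0 ^ 2 + x 1 ^ 2 + x 2 ^ 2) ^ 3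
    rw [add_assoc (1 + x 0 ^ 2), key, ← add_assoc]
  obtain ⟨m₃, hm₃d, hm₃i, hred⟩ : ∃ m₃ : KZ.IntegralRep 2,
      m₃.domain = {p | 0 < p (Fin.last 1) ∧ (Fin.snoc p 0 : Fin 3 → ℝ) ∈ r.domain} ∧
      (m₃.integrand = fun p => 2 * p (Fin.last 1) * r.integrand (Fin.snoc p 0 : Fin 3 → ℝ)) ∧
      KZ.of r - KZ.of m₃ * KZ.of KZ.piRep ∈ KZ.relations :=
    rotation_reduce (n := 1) r hinv
  have hm₃d' : m₃.domain = {p : Fin 2 → ℝ | 0 < p 1} := by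
    rw [hm₃d, hrd]
    exact Set.ext fun p => by simp only [mem_setOf_eq, mem_univ, and_true]; exact Iff.rfl
  have hm₃i' : ∀ p : Fin 2 → ℝ, m₃.integrand p = 16 * p 1 / (1 + p 0 ^ 2 + p 1 ^ 2) ^ 3 := by
    intro p
    rw [hm₃i, hri']
    show 2 * p 1 * (8 / (1 + p 0 ^ 2 + p 1 ^ 2 + (0 : ℝ) ^ 2) ^ 3) = _
    ring
  -- Step 2: ONE change of variables along the scaling chart of the upper half-plane
  obtain ⟨m₄, hm₄d, hm₄i, hrel⟩ := tateLifting_pullback 2 m₃ {p : Fin 2 → ℝ | 0 < p 1}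
    (fun y : Fin 2 → ℝ => (![y 0, y 1 * √(1 + y 0 ^ 2)] : Fin 2 → ℝ))
    (fun z => LinearMap.toContinuousLinearMap
      (Matrix.toLin' !![(1 : ℝ), 0; z 1 * (z 0 / √(1 + z 0 ^ 2)), √(1 + z 0 ^ 2)]))
    (fun z => √(1 + z 0 ^ 2)) isSemialgebraic_pos1 isSemialgebraicMapOn_scale
    (fun z _ => (hasFDerivAt_scale z).hasFDerivWithinAt) injOn_scale
    (by rw [hm₃d']; exact image_scale) isSemialgebraicFunOn_jac (fun z _ => (abs_det_scale z).symm)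
  -- Step 3: the pulled-back representation is the product `A × m` of the two honest factors
  obtain ⟨A, hAd, hAi, hAv⟩ := exists_quarticRep
  obtain ⟨m, hmd, hmi, hmv⟩ := exists_meridianRep
  have hprod : KZ.of m₄ - KZ.of (A.prod m) ∈ KZ.relations := by
    refine KZ.of_sub_of_mem_relations_of_eqOn ?_ fun p _ => ?_
    · rw [hm₄d, KZ.IntegralRep.prod_domain]
      ext p
      simp only [KZ.IntegralRep.mem_prodDomain, hAd, hmd, mem_univ, true_and, mem_setOf_eq, hn0]
    · rw [hm₄i, KZ.IntegralRep.prod_integrand_eq, KZ.IntegralRep.prodFun_apply, hAi, hmi]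
      dsimp only
      rw [hm₃i']
      simp only [Matrix.cons_val_zero, Matrix.cons_val_one, Matrix.cons_val_fin_one, hc0, hn0]
      obtain ⟨s, hs0, hs2, hs⟩ : ∃ s : ℝ, 0 < s ∧ s ^ 2 = 1 + p 0 ^ 2 ∧ √(1 + p 0 ^ 2) = s :=
        ⟨_, Real.sqrt_pos.2 (by positivity), Real.sq_sqrt (by positivity), rfl⟩
      have hs0' : s ≠ 0 := hs0.ne'
      have h1 : (1 + p 1 ^ 2 : ℝ) ≠ 0 := by positivity
      rw [hs, ← hs2]
      have h2 : (s ^ 2 + (p 1 * s) ^ 2 : ℝ) ≠ 0 := by positivity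
      field_simp
  -- Step 4: the two identities of the dimension-≤ 1 algebraic sector (values `4` and `2·π/2 = π`)
  obtain ⟨L, hLd, hLi⟩ := Summit.KontsevichZagierPeriods.CobordismMove.CP2Volume.exists_cauchyRep₁
  have hLv : L.value = Real.pi := by
    rw [KZ.IntegralRep.value, hLd, hLi, integral_fin_one_univ (fun t => 1 / (1 + t ^ 2))]
    simpa only [one_div] using integral_univ_inv_one_add_sq
  have hm4 : KZ.of m - 4 • KZ.of KZ.IntegralRep.unit ∈ KZ.relations := by
    refine kzKernelConjecture_lowDimAlg _ (AddSubgroup.sub_mem _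
      (of_mem_lowDimGen m (Polynomial.C 16 * Polynomial.X) ((1 + Polynomial.X ^ 2) ^ 3)
        (fun x _ => ?_) (fun x _ => ?_)) (AddSubgroup.nsmul_mem _ ?_ 4)) ?_
    · rw [eval_cube]; positivity
    · simp only [hmi, eval_sixteenX, eval_cube]
    · exact AddSubgroup.subset_closure (Or.inl ⟨KZ.IntegralRep.unit, rfl⟩)
    · rw [map_sub, map_nsmul, KZ.eval_of, KZ.eval_of, hmv, KZ.IntegralRep.value_unit]
      norm_num
  have hAL : 2 • KZ.of A - KZ.of L ∈ KZ.relations := by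
    refine kzKernelConjecture_lowDimAlg _ (AddSubgroup.sub_mem _
      (AddSubgroup.nsmul_mem _ (of_mem_lowDimGen A 1 ((1 + Polynomial.X ^ 2) ^ 2)
        (fun x _ => ?_) (fun x _ => ?_)) 2)
      (of_mem_lowDimGen L 1 (1 + Polynomial.X ^ 2) (fun x _ => ?_) (fun x _ => ?_))) ?_
    · rw [SphereChart.eval_den]; positivity
    · simp only [hAi, Polynomial.map_one, Polynomial.eval_one, SphereChart.eval_den]
    · rw [eval_oneAddSq]; positivity
    · simp only [hLi, Polynomial.map_one, Polynomial.eval_one, eval_oneAddSq]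
    · rw [map_sub, map_nsmul, KZ.eval_of, KZ.eval_of, hAv, hLv, nsmul_eq_mul]
      ring
  -- Step 5: `[D × D, 1]` is the product of two open discs, i.e. of two closed discs
  have hdom : r'.domain = (discRep.prod discRep).domain := by
    rw [hr'd, KZ.IntegralRep.prod_domain]
    ext w
    simp only [mem_setOf_eq]
    exact Iff.rfl
  have hdisc : KZ.of (discRep.prod discRep) - KZ.of r' ∈ KZ.relations := by
    refine KZ.of_sub_of_mem_relations_of_eqOn hdom fun z hz => ?_
    rw [KZ.IntegralRep.prod_integrand_eq, KZ.IntegralRep.prodFun_apply, hr'i (by rw [hdom]; exact hz)]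
    exact mul_one 1
  have hdd : KZ.toFormalPeriod (KZ.of r') =
      KZ.toFormalPeriod (KZ.of KZ.piRep) * KZ.toFormalPeriod (KZ.of KZ.piRep) := by
    rw [← KZ.toFormalPeriod_eq_iff.mpr hdisc, ← KZ.of_mul_of, map_mul,
      ← equivalent_piRep_discRep.toFormalPeriod_eq]
  -- Step 6: bookkeeping in the commutative formal period ring `FormalRep ⧸ relations`:
  -- `⟦r⟧ = ⟦A⟧·⟦m⟧·⟦π⟧`, `⟦m⟧ = 4`, `2⟦A⟧ = ⟦L⟧ = ⟦π⟧`, `⟦r'⟧ = ⟦π⟧²`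
  have e3 : 2 * KZ.toFormalPeriod (KZ.of A) = KZ.toFormalPeriod (KZ.of KZ.piRep) := by
    rw [← (TubeIsTwist.cauchy_equivalent_piRep L hLd hLi).toFormalPeriod_eq,
      ← KZ.toFormalPeriod_eq_iff.mpr hAL, map_nsmul, nsmul_eq_mul, Nat.cast_ofNat]
  rw [← KZ.toFormalPeriod_eq_zero_iff, map_sub, map_nsmul, hdd, KZ.toFormalPeriod_eq_iff.mpr hred, map_mul,
    KZ.toFormalPeriod_eq_iff.mpr hrel, KZ.toFormalPeriod_eq_iff.mpr hprod, ← KZ.of_mul_of, map_mul,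
    KZ.toFormalPeriod_eq_iff.mpr hm4, map_nsmul, KZ.toFormalPeriod_of_unit, nsmul_eq_mul, nsmul_eq_mul]
  push_cast
  linear_combination (2 * KZ.toFormalPeriod (KZ.of KZ.piRep)) * e3

end Summit.KontsevichZagierPeriods.InverseLandau

end
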